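import Literature.IUT.LogThetaLattice.EtalePictureChainProofs
import Literature.IUT.LogThetaLattice.StripFrameWitness
import HarnessLib

/-!
# [IUTchIII] Corollary 2.3 (ii), non-vacuity: in the §1–§2 witness frame the hub identifications are a
# two-element class, not a single isomorphism (proof-only sanity companion of `EtalePictureChainProofs.lean`)

Mochizuki, *Inter-universal Teichmüller Theory III*, kurims manuscript (May 2020), §2, Corollary 2.3 (ii) p.74
[cite: Mochizuki2012, III Cor 2.3 (ii) p.74] (D-0012 claim key, status DISPUTED). KIT-RULE-style sanity file
(abc-iut cell, layer L6; nothing asserted about the intended objects; takes no side on [IUTchIII] Cor 3.12): the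
constructions of `EtalePictureChainProofs.lean` (`ThetaCoricData.coricPolyIso`, `etalePictureCoric`) evaluated
in abc-iut-L6-t3's WITNESS `ThetaCoricData` (`StripFrameWitness.twoCoric`: every prime-strip category is the
one-object groupoid `Pt` with automorphism group `ℤˣ = {±1}`, `F^{⊢×μ}(−) = 𝟭`).

What is PROVED: the identification of coric data induced by the automorphism `−1` of the `D^⊢`-prime-strip
belongs to the hub identifications and is NOT the identity (`two_isoOfDv_negIso_ne_refl`), so the coric
identifications "via these poly-isomorphisms" — and hence the poly-isomorphisms GENERATED along a horizontal line
of the étale-picture (Fig. 2.4), by `etalePictureCoric_eq` — form a class with (at least) two elements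
(`two_coricPolyIso_not_subsingleton`, `two_etalePictureCoric_not_subsingleton`): in the kernel, as in print,
the hub `F^{⊢×μ}_△(^{◦,◦}D^⊢_△)` is an object "identified up to" the automorphisms of the `D^⊢`-prime-strips, not up to a
unique isomorphism. This also shows that the theorems of `EtalePictureChainProofs.lean` are not about empty or
one-element poly-isomorphisms only.
-/

namespace Literature.IUT.LogThetaLattice

open CategoryTheory
open Literature.IUT.HodgeTheaters

namespace Witness

/-- **IUTchIII:Cor2.3(ii)** (kurims p.74) in the witness frame, the coric identification induced by the
automorphism `−1` of the `D^⊢`-prime-strip is one of the hub identifications. [claim: Mochizuki2012, status: disputed] -/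
theorem two_isoOfDv_negIso_mem : twoCoric.isoOfDv negIso ∈ twoCoric.coricPolyIso pt pt :=
  twoCoric.isoOfDv_mem_coricPolyIso negIso

/-- **IUTchIII:Cor2.3(ii)** (kurims p.74) … and it is not the identity (its (a_{Morℭ})-component is `−1 ≠ 1`).
[claim: Mochizuki2012, status: disputed] -/
theorem two_isoOfDv_negIso_ne_refl : twoCoric.isoOfDv negIso ≠ Iso.refl _ := by
  intro h
  apply negIso_ne_refl
  have hd := congrArg (fun i : (⟨pt⟩ : Coric twoCoric) ≅ ⟨pt⟩ => i.hom.d) h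
  simp only [ThetaCoricData.isoOfDv_hom_d, Iso.refl_hom, Coric.id_d] at hd
  exact hd

/-- **IUTchIII:Cor2.3(ii)** (kurims p.74) hence the hub identifications between two coric data of the witness
frame are NOT a single isomorphism: the class has at least the two elements induced by `+1` and `−1`.
[claim: Mochizuki2012, status: disputed] -/
theorem two_coricPolyIso_not_subsingleton : ¬ (twoCoric.coricPolyIso pt pt).Subsingleton := by
  intro h
  apply two_isoOfDv_negIso_ne_refl
  have h1 : twoCoric.isoOfDv (Iso.refl pt) = Iso.refl _ :=
    Iso.ext (Coric.hom_ext rfl (Functor.mapIso_refl _ _))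
  rw [← h1]
  exact h (twoCoric.isoOfDv_mem_coricPolyIso negIso) (twoCoric.isoOfDv_mem_coricPolyIso (Iso.refl pt))

/-- **IUTchIII:Cor2.3(ii)** (kurims p.74) consequently the poly-isomorphism GENERATED along a horizontal line of the
étale-picture of radial data over the witness frame (any family of `D`-Hodge theaters, any line `m`, any two
spokes `a`, `b`) is not a single isomorphism either (`etalePictureCoric_eq`). [claim: Mochizuki2012, status: disputed] -/
theorem two_etalePictureCoric_not_subsingleton (H : ℤ × ℤ → twoFrame.DHT) (m a b : ℤ) :
    ¬ (etalePictureCoric twoCoric H m a b).Subsingleton := by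
  rw [etalePictureCoric_eq]
  exact two_coricPolyIso_not_subsingleton

/-- **IUTchIII:Cor2.3(ii)** (kurims p.74) ↦ **[IUTchII] Cor 4.11 (i)**: and its projection to the
`D^⊢`-prime-strips is the full (two-element) poly-isomorphism `{+1, −1}` of the witness `D^⊢_△`
(`image_d_etalePictureCoric`), in particular not a singleton. [claim: Mochizuki2012, status: disputed] -/
theorem two_image_d_etalePictureCoric_not_subsingleton (H : ℤ × ℤ → twoFrame.DHT) (m a b : ℤ) :
    ¬ ((fun i => i.hom.d) '' etalePictureCoric twoCoric H m a b).Subsingleton := by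
  rw [image_d_etalePictureCoric]
  intro h
  exact negIso_ne_refl (h (PolyIso.mem_full negIso) (PolyIso.mem_full (Iso.refl pt)))

end Witness

end Literature.IUT.LogThetaLattice
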